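import Summits.ValiantsHypothesis.ValiantsHypothesis.Theorems.BorderApolarityFixedWitnessObstructionQPReduction
import Summits.ValiantsHypothesis.ValiantsHypothesis.Theorems.BorderApolarityFixedWitnessObstructionQPDeborderOrder
import Summits.ValiantsHypothesis.ValiantsHypothesis.Theorems.BorderApolarityFixedWitnessObstructionQPDeborderFrame
import Summits.ValiantsHypothesis.ValiantsHypothesis.Theorems.BorderApolarityToricWitnessObstructionQPOfToricDeborder
import Literature.Computability.AlgebraicComplexity.BorderApolarityMembership

/-!
# Border apolarity, crux `FixedWitnessObstructionQP` — the ORDER chain of line `toric-face-debordering`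

Route `ValiantsHypothesis/BorderApolarity`, crux item `stmt-ValiantsHypothesis-5778` (and its child crux 4,
stmt-14753), line `toric-face-debordering`, reshapes 4/4b (lead seat -2).  The line's one open stub is
`ToricDeborderQP` ("an EXTREMAL toric representation `pp_{n,m} = u · in_w(g · det_m)` at size `m` forces
`dc(per_n) ≤ 2^polylog(m)`").  Seat -1 reduced it to the HEIGHT bound `WeightBoundQP` (`toricDeborderQP_of_weightBoundMax`,
`…QPReduction.lean`).  This file lands the kernel-checked chain of successively WEAKER sufficient conditions

  `WeightBoundQP ⟹ PotentialGapQP ⟹ OrderBoundQP ⟹ ToricDeborderQP`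

over the landed de-bordering by order (`stub_deborderOrder`, `…QPDeborderOrder.lean`) and frame change by potentials
(`stub_deborderFrame`, `…QPDeborderFrame.lean`):

* `toricDeborderQP_of_orderBoundQP` — `OrderBoundQP`: the extremal toric representation can be traded for
  `pp = u · [ε^k] det (B₀ + ε B₁ + ⋯ + ε^k B_k)`, linear layers, `k ≤ 2^polylog(m)`; then `dc(per_n) ≤ 2^polylog(m)`.
* `orderBoundQP_of_potentialGapQP` — `PotentialGapQP`: a toric representation with FEASIBLE POTENTIALS `p, q` (Egerváry)
  whose gap `Σp + Σq − e` is `≤ 2^polylog(m)`; then `OrderBoundQP` (the slice is the order-gap coefficient of the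
  potential-rescaled family).  By Egerváry duality (`Literature/Combinatorics/Optimization/EgervaryDuality.lean`, proposed)
  the least `Σp + Σq` is the tropical determinant of the entry-weight matrix, so `PotentialGapQP` = Murota's gap
  `tropdet − deg ≤ 2^polylog(m)` for some extremal toric representation (crux 4's card `mvmp-order-debordering`).
* `potentialGapQP_of_weightBoundMax` — trivial potentials `p ≡ max w`, `q ≡ 0`.
* `toricDeborderQP_of_potentialGapQP` (registered stub) — the composite; `toricWitnessObstructionQP_of_potentialGapQP`,
  `fixedWitnessObstructionQP_of_potentialGapQP` — cruxes 4 and 2 from `PotentialGapQP` + eventual super-qp `dc(per_n)`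
  (+ `ToricFixedPoints` for crux 2).
* `hasDetRepr_of_tight_potentials` — gap `0` (a TIGHT frame, Murota's generic case) de-borders for free: `dc(per_n) ≤ m`.

Everything here is per/det-blind glue; the per-content stays in the external eventual affine hardness of the permanent.
-/

open scoped BigOperators Matrix Polynomial
open Literature.Computability.AlgebraicComplexity

namespace Summit.ValiantsHypothesis.ValiantsHypothesis.Theorems.BorderApolarityFixedWitnessObstructionQP

set_option linter.dupNamespace false

/-- **`OrderBoundQP ⇒ ToricDeborderQP` (reshape 4, seat -2), kernel-checked over the landed de-bordering BY
ORDER.**  `OrderBoundQP` (the hypothesis `hO`, the line's NEW open sufficient condition, weaker than the polyhedral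
`WeightBoundQP`): an extremal toric representation of `pp_{n,m}` can be traded for a representation of `pp_{n,m}` as a
translate of the ORDER-`k` coefficient `[ε^k] det (B₀ + ε B₁ + ⋯ + ε^k B_k)` of a holomorphic family of `m × m` matrices
of LINEAR forms with `k ≤ 2^((log₂ m + c₁)^c₁)` (any frame: e.g. the Egerváry rescaling
`diag(ε^p) · (g·x)(ε^{-w} x) · diag(ε^q)` of the toric family, whose order is `Σp + Σq − e ≤ m · max w`).  Then
`dc(per_n) ≤ 2^((log₂ m + c')^c')`: the coefficient is an honest determinant of size `C₀((m+1)(k+1))^e₀`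
(`stub_deborderOrder`, LANDED p96327, `…QPDeborderOrder.lean`), so is its translate `pp` (`hasDetRepr_linSubst`), hence
`per_n` (`stub_unpad`), and the size is quasi-polynomial in `m` (`qp_absorb` at `n = m`, `c = 1`). -/
theorem toricDeborderQP_of_orderBoundQP
    (hO : ∃ c₁ : ℕ, ∀ (n m : ℕ) [NeZero m], 3 ≤ n → n ≤ m →
    (∃ (u g : Matrix.GeneralLinearGroup (Fin m × Fin m) ℂ) (w : Fin m × Fin m → ℕ) (e : ℕ),
        (∀ d ∈ (linSubst (Fin m × Fin m) ℂ (g : Matrix (Fin m × Fin m) (Fin m × Fin m) ℂ) (detPoly (Fin m) ℂ)).support,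
          Finsupp.weight w d ≤ e) ∧
        paddedPerPoly ℂ n m =
          linSubst (Fin m × Fin m) ℂ (u : Matrix (Fin m × Fin m) (Fin m × Fin m) ℂ)
            (MvPolynomial.weightedHomogeneousComponent w e
              (linSubst (Fin m × Fin m) ℂ (g : Matrix (Fin m × Fin m) (Fin m × Fin m) ℂ) (detPoly (Fin m) ℂ)))) →
      ∃ (k : ℕ) (u : Matrix (Fin m × Fin m) (Fin m × Fin m) ℂ)
        (B : ℕ → Matrix (Fin m) (Fin m) (MvPolynomial (Fin m × Fin m) ℂ)),
        k ≤ 2 ^ ((Nat.log 2 m + c₁) ^ c₁) ∧ (∀ j a b, (B j a b).IsHomogeneous 1) ∧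
        paddedPerPoly ℂ n m = linSubst (Fin m × Fin m) ℂ u
          ((Matrix.det (Matrix.of fun a b =>
            ∑ j ∈ Finset.range (k + 1), Polynomial.monomial j (B j a b))).coeff k)) :
    ∃ c₁ : ℕ, ∀ (n m : ℕ) [NeZero m], 3 ≤ n → n ≤ m →
    (∃ (u g : Matrix.GeneralLinearGroup (Fin m × Fin m) ℂ) (w : Fin m × Fin m → ℕ) (e : ℕ),
        (∀ d ∈ (linSubst (Fin m × Fin m) ℂ (g : Matrix (Fin m × Fin m) (Fin m × Fin m) ℂ) (detPoly (Fin m) ℂ)).support,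
          Finsupp.weight w d ≤ e) ∧
        paddedPerPoly ℂ n m =
          linSubst (Fin m × Fin m) ℂ (u : Matrix (Fin m × Fin m) (Fin m × Fin m) ℂ)
            (MvPolynomial.weightedHomogeneousComponent w e
              (linSubst (Fin m × Fin m) ℂ (g : Matrix (Fin m × Fin m) (Fin m × Fin m) ℂ) (detPoly (Fin m) ℂ)))) →
      determinantalComplexity (perPoly (Fin n) ℂ) ≤ 2 ^ ((Nat.log 2 m + c₁) ^ c₁) := by
  obtain ⟨c₁, hO⟩ := hO
  obtain ⟨C₀, e₀, hD⟩ := stub_deborderOrder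
  obtain ⟨c', hc'⟩ := qp_absorb 1 c₁ C₀ e₀
  refine ⟨c', fun n m inst h3 hnm hrep => ?_⟩
  obtain ⟨k, u, B, hk, hB, hpp⟩ := @hO n m inst h3 hnm hrep
  have hcoef := hD (Fin m × Fin m) m k B hB
  have hpad : HasDetRepr (paddedPerPoly ℂ n m) (C₀ * ((m + 1) * (k + 1)) ^ e₀) := by
    rw [hpp]
    exact hasDetRepr_linSubst _ hcoef
  have hper := stub_unpad n m hnm _ hpad
  have hmono : C₀ * ((m + 1) * (k + 1)) ^ e₀ ≤
      C₀ * ((m + 1) * (2 ^ ((Nat.log 2 m + c₁) ^ c₁) + 1)) ^ e₀ :=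
    Nat.mul_le_mul_left _ (Nat.pow_le_pow_left (Nat.mul_le_mul_left _ (by omega)) _)
  have hm : m ≤ 2 ^ ((Nat.log 2 m + 1) ^ 1) := by
    rw [pow_one]
    exact (Nat.lt_pow_succ_log_self Nat.one_lt_two m).le
  exact (determinantalComplexity_le_of_hasDetRepr hper).trans (hmono.trans (hc' m m hm))

/-- **`PotentialGapQP ⇒ OrderBoundQP` (reshape 4b, seat -2), kernel-checked over the landed FRAME CHANGE.**
`PotentialGapQP` (the hypothesis `hP`): an extremal toric representation of `pp_{n,m}` can be traded for a toric
representation `pp = u · wHC_w^e (g · det_m)` (any square `u, g`) that carries FEASIBLE POTENTIALS `p, q : Fin m → ℕ`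
(`wHC_w^j (g · x_ab) = 0` for `j > p_a + q_b`, i.e. `p_a + q_b ≥` the weight of every variable in entry `(a,b)`) whose GAP
`Σp + Σq − e` is at most `2^((log₂ m + c₁)^c₁)`.  By `stub_deborderFrame` (…QPDeborderFrame.lean) the slice is then the
order-`(Σp + Σq − e)` coefficient of the family with linear layers `wHC_w^{p_a+q_b−i} (g · x_ab)`, which is `OrderBoundQP`'s input.
By Egerváry's duality the least `Σp + Σq` over feasible integer potentials is the tropical determinant of the entry-weight
matrix, so `PotentialGapQP` reads: Murota's gap `tropdet(ν) − deg_t det ≤ 2^polylog(m)` for some extremal toric representation —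
the `k₀` of crux 4's card `mvmp-order-debordering`. -/
theorem orderBoundQP_of_potentialGapQP
    (hP : ∃ c₁ : ℕ, ∀ (n m : ℕ) [NeZero m], 3 ≤ n → n ≤ m →
    (∃ (u g : Matrix.GeneralLinearGroup (Fin m × Fin m) ℂ) (w : Fin m × Fin m → ℕ) (e : ℕ),
        (∀ d ∈ (linSubst (Fin m × Fin m) ℂ (g : Matrix (Fin m × Fin m) (Fin m × Fin m) ℂ) (detPoly (Fin m) ℂ)).support,
          Finsupp.weight w d ≤ e) ∧
        paddedPerPoly ℂ n m =
          linSubst (Fin m × Fin m) ℂ (u : Matrix (Fin m × Fin m) (Fin m × Fin m) ℂ)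
            (MvPolynomial.weightedHomogeneousComponent w e
              (linSubst (Fin m × Fin m) ℂ (g : Matrix (Fin m × Fin m) (Fin m × Fin m) ℂ) (detPoly (Fin m) ℂ)))) →
      ∃ (u g : Matrix (Fin m × Fin m) (Fin m × Fin m) ℂ) (w : Fin m × Fin m → ℕ) (e : ℕ) (p q : Fin m → ℕ),
        (∀ a b j, p a + q b < j →
          MvPolynomial.weightedHomogeneousComponent w j (linSubst (Fin m × Fin m) ℂ g (MvPolynomial.X (a, b))) = 0) ∧
        e ≤ ∑ a, p a + ∑ b, q b ∧
        ∑ a, p a + ∑ b, q b - e ≤ 2 ^ ((Nat.log 2 m + c₁) ^ c₁) ∧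
        paddedPerPoly ℂ n m = linSubst (Fin m × Fin m) ℂ u
          (MvPolynomial.weightedHomogeneousComponent w e (linSubst (Fin m × Fin m) ℂ g (detPoly (Fin m) ℂ)))) :
    ∃ c₁ : ℕ, ∀ (n m : ℕ) [NeZero m], 3 ≤ n → n ≤ m →
    (∃ (u g : Matrix.GeneralLinearGroup (Fin m × Fin m) ℂ) (w : Fin m × Fin m → ℕ) (e : ℕ),
        (∀ d ∈ (linSubst (Fin m × Fin m) ℂ (g : Matrix (Fin m × Fin m) (Fin m × Fin m) ℂ) (detPoly (Fin m) ℂ)).support,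
          Finsupp.weight w d ≤ e) ∧
        paddedPerPoly ℂ n m =
          linSubst (Fin m × Fin m) ℂ (u : Matrix (Fin m × Fin m) (Fin m × Fin m) ℂ)
            (MvPolynomial.weightedHomogeneousComponent w e
              (linSubst (Fin m × Fin m) ℂ (g : Matrix (Fin m × Fin m) (Fin m × Fin m) ℂ) (detPoly (Fin m) ℂ)))) →
      ∃ (k : ℕ) (u : Matrix (Fin m × Fin m) (Fin m × Fin m) ℂ)
        (B : ℕ → Matrix (Fin m) (Fin m) (MvPolynomial (Fin m × Fin m) ℂ)),
        k ≤ 2 ^ ((Nat.log 2 m + c₁) ^ c₁) ∧ (∀ j a b, (B j a b).IsHomogeneous 1) ∧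
        paddedPerPoly ℂ n m = linSubst (Fin m × Fin m) ℂ u
          ((Matrix.det (Matrix.of fun a b =>
            ∑ j ∈ Finset.range (k + 1), Polynomial.monomial j (B j a b))).coeff k) := by
  obtain ⟨c₁, hP⟩ := hP
  refine ⟨c₁, fun n m inst h3 hnm hrep => ?_⟩
  obtain ⟨u, g, w, e, p, q, hfeas, he, hgap, hpp⟩ := @hP n m inst h3 hnm hrep
  -- the matrix of linear forms `L = g · x` with `det L = g · det_m`
  set L : Matrix (Fin m) (Fin m) (MvPolynomial (Fin m × Fin m) ℂ) :=
    (linSubst (Fin m × Fin m) ℂ g).toRingHom.mapMatrix (Matrix.mvPolynomialX (Fin m) (Fin m) ℂ) with hL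
  have hLab : ∀ a b, L a b = linSubst (Fin m × Fin m) ℂ g (MvPolynomial.X (a, b)) := fun a b => by
    simp only [hL, RingHom.mapMatrix_apply, Matrix.map_apply, Matrix.mvPolynomialX_apply]; rfl
  have hdet : linSubst (Fin m × Fin m) ℂ g (detPoly (Fin m) ℂ) = L.det := by
    rw [hL, detPoly, ← RingHom.map_det]; rfl
  have hlin : ∀ a b, (L a b).IsHomogeneous 1 := fun a b => by
    rw [hLab]; exact linSubst_isHomogeneous g (MvPolynomial.isHomogeneous_X ℂ (a, b))
  have hfeasL : ∀ a b j, p a + q b < j → MvPolynomial.weightedHomogeneousComponent w j (L a b) = 0 :=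
    fun a b j hj => by rw [hLab]; exact hfeas a b j hj
  refine ⟨∑ a, p a + ∑ b, q b - e, u, fun i => Matrix.of fun a b =>
      if i ≤ p a + q b then MvPolynomial.weightedHomogeneousComponent w (p a + q b - i) (L a b) else 0,
    hgap, fun i a b => ?_, ?_⟩
  · simp only [Matrix.of_apply]
    split_ifs
    · exact isHomogeneous_weightedHomogeneousComponent (hlin a b) w _
    · exact MvPolynomial.isHomogeneous_zero _ _ _
  · rw [hpp, hdet, stub_deborderFrame (Fin m × Fin m) (Fin m) L hlin w e p q hfeasL he]
    rfl

/-- **`WeightBoundQP ⇒ PotentialGapQP` (reshape 4b): the trivial potentials.**  A bounded-weight representation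
(`w ≤ W = 2^((log₂ m + c₁)^c₁)`) carries the feasible potentials `p ≡ W`, `q ≡ 0` with gap `m W − e ≤ m W`, and
`e ≤ m W` because `pp ≠ 0`.  Hence the chain `WeightBoundQP ⇒ PotentialGapQP ⇒ OrderBoundQP ⇒ ToricDeborderQP` is
kernel-checked end to end, each implication a weakening of the open hypothesis. -/
theorem potentialGapQP_of_weightBoundMax
    (hW : ∃ c₁ : ℕ, ∀ (n m : ℕ) [NeZero m], 3 ≤ n → n ≤ m →
    (∃ (u g : Matrix.GeneralLinearGroup (Fin m × Fin m) ℂ) (w : Fin m × Fin m → ℕ) (e : ℕ),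
        (∀ d ∈ (linSubst (Fin m × Fin m) ℂ (g : Matrix (Fin m × Fin m) (Fin m × Fin m) ℂ) (detPoly (Fin m) ℂ)).support,
          Finsupp.weight w d ≤ e) ∧
        paddedPerPoly ℂ n m =
          linSubst (Fin m × Fin m) ℂ (u : Matrix (Fin m × Fin m) (Fin m × Fin m) ℂ)
            (MvPolynomial.weightedHomogeneousComponent w e
              (linSubst (Fin m × Fin m) ℂ (g : Matrix (Fin m × Fin m) (Fin m × Fin m) ℂ) (detPoly (Fin m) ℂ)))) →
      ∃ (u g : Matrix.GeneralLinearGroup (Fin m × Fin m) ℂ) (w : Fin m × Fin m → ℕ) (e : ℕ),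
        (∀ i, w i ≤ 2 ^ ((Nat.log 2 m + c₁) ^ c₁)) ∧
        paddedPerPoly ℂ n m =
          linSubst (Fin m × Fin m) ℂ (u : Matrix (Fin m × Fin m) (Fin m × Fin m) ℂ)
            (MvPolynomial.weightedHomogeneousComponent w e
              (linSubst (Fin m × Fin m) ℂ (g : Matrix (Fin m × Fin m) (Fin m × Fin m) ℂ) (detPoly (Fin m) ℂ)))) :
    ∃ c₁ : ℕ, ∀ (n m : ℕ) [NeZero m], 3 ≤ n → n ≤ m →
    (∃ (u g : Matrix.GeneralLinearGroup (Fin m × Fin m) ℂ) (w : Fin m × Fin m → ℕ) (e : ℕ),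
        (∀ d ∈ (linSubst (Fin m × Fin m) ℂ (g : Matrix (Fin m × Fin m) (Fin m × Fin m) ℂ) (detPoly (Fin m) ℂ)).support,
          Finsupp.weight w d ≤ e) ∧
        paddedPerPoly ℂ n m =
          linSubst (Fin m × Fin m) ℂ (u : Matrix (Fin m × Fin m) (Fin m × Fin m) ℂ)
            (MvPolynomial.weightedHomogeneousComponent w e
              (linSubst (Fin m × Fin m) ℂ (g : Matrix (Fin m × Fin m) (Fin m × Fin m) ℂ) (detPoly (Fin m) ℂ)))) →
      ∃ (u g : Matrix (Fin m × Fin m) (Fin m × Fin m) ℂ) (w : Fin m × Fin m → ℕ) (e : ℕ) (p q : Fin m → ℕ),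
        (∀ a b j, p a + q b < j →
          MvPolynomial.weightedHomogeneousComponent w j (linSubst (Fin m × Fin m) ℂ g (MvPolynomial.X (a, b))) = 0) ∧
        e ≤ ∑ a, p a + ∑ b, q b ∧
        ∑ a, p a + ∑ b, q b - e ≤ 2 ^ ((Nat.log 2 m + c₁) ^ c₁) ∧
        paddedPerPoly ℂ n m = linSubst (Fin m × Fin m) ℂ u
          (MvPolynomial.weightedHomogeneousComponent w e (linSubst (Fin m × Fin m) ℂ g (detPoly (Fin m) ℂ))) := by
  obtain ⟨c₁, hW⟩ := hW
  obtain ⟨c', hc'⟩ := qp_absorb 1 c₁ 1 1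
  refine ⟨c', fun n m inst h3 hnm hrep => ?_⟩
  obtain ⟨u, g, w, e, hw, hpp⟩ := @hW n m inst h3 hnm hrep
  set W : ℕ := 2 ^ ((Nat.log 2 m + c₁) ^ c₁) with hWdef
  have hsum : ∑ _a : Fin m, W + ∑ _b : Fin m, (0 : ℕ) = m * W := by
    simp [Finset.sum_const, Finset.card_univ, Fintype.card_fin]
  -- `e ≤ m W` since `pp ≠ 0`
  have he : e ≤ m * W := by
    by_contra he
    have hzero : MvPolynomial.weightedHomogeneousComponent w e
        (linSubst (Fin m × Fin m) ℂ (g : Matrix (Fin m × Fin m) (Fin m × Fin m) ℂ) (detPoly (Fin m) ℂ)) = 0 := by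
      rw [MvPolynomial.weightedHomogeneousComponent_eq_zero']
      intro d hd hde
      have hhom : (linSubst (Fin m × Fin m) ℂ (g : Matrix (Fin m × Fin m) (Fin m × Fin m) ℂ)
          (detPoly (Fin m) ℂ)).IsHomogeneous m := by
        simpa using linSubst_isHomogeneous (g : Matrix (Fin m × Fin m) (Fin m × Fin m) ℂ)
          (detPoly_isHomogeneous (n := Fin m) (k := ℂ))
      have hdeg : Finsupp.weight (1 : Fin m × Fin m → ℕ) d = m := hhom (MvPolynomial.mem_support_iff.mp hd)
      have hle := weight_le_mul_weight_one w W hw d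
      rw [hdeg, hde, mul_comm] at hle
      exact he hle
    rw [hzero, map_zero] at hpp
    exact Literature.Computability.AlgebraicComplexity.BorderApolarity.paddedPerPoly_ne_zero n m hpp
  refine ⟨(u : Matrix (Fin m × Fin m) (Fin m × Fin m) ℂ), (g : Matrix (Fin m × Fin m) (Fin m × Fin m) ℂ), w, e,
    fun _ => W, fun _ => 0, fun a b j hj => ?_, ?_, ?_, hpp⟩
  · -- feasibility: a variable has weight `≤ W < j`
    dsimp only at hj
    rw [MvPolynomial.weightedHomogeneousComponent_eq_zero']
    intro d hd hde
    have hhom : (linSubst (Fin m × Fin m) ℂ (g : Matrix (Fin m × Fin m) (Fin m × Fin m) ℂ)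
        (MvPolynomial.X (a, b))).IsHomogeneous 1 :=
      linSubst_isHomogeneous _ (MvPolynomial.isHomogeneous_X ℂ (a, b))
    have hdeg : Finsupp.weight (1 : Fin m × Fin m → ℕ) d = 1 := hhom (MvPolynomial.mem_support_iff.mp hd)
    have hle := weight_le_mul_weight_one w W hw d
    rw [hdeg, hde, mul_one] at hle
    omega
  · rw [hsum]; exact he
  · rw [hsum]
    have hm : m ≤ 2 ^ ((Nat.log 2 m + 1) ^ 1) := by
      rw [pow_one]
      exact (Nat.lt_pow_succ_log_self Nat.one_lt_two m).le
    have h1 := hc' m m hm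
    rw [one_mul, pow_one] at h1
    calc m * W - e ≤ m * W := Nat.sub_le _ _
      _ ≤ (m + 1) * (W + 1) := Nat.mul_le_mul (Nat.le_succ m) (Nat.le_succ _)
      _ ≤ 2 ^ ((Nat.log 2 m + c') ^ c') := h1

/-- **Tight frames de-border for free** (gap `0`, the generic case of Murota's combinatorial relaxation; branch (T) of
crux 4's card `graded-tight-matrix-dichotomy`).  If a toric slice `u · wHC_w^e (g · det_m)` (any square `u, g`) carries
feasible potentials with `Σp + Σq = e`, then it is `u ·` the determinant of the TIGHT LAYER `(wHC_w^{p_a+q_b} (g · x_ab))_ab`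
of linear forms — an HONEST determinant of size `m`. [folklore] -/
theorem hasDetRepr_slice_of_tight_potentials {m : ℕ}
    (u g : Matrix (Fin m × Fin m) (Fin m × Fin m) ℂ) (w : Fin m × Fin m → ℕ) (e : ℕ) (p q : Fin m → ℕ)
    (hfeas : ∀ a b j, p a + q b < j →
      MvPolynomial.weightedHomogeneousComponent w j (linSubst (Fin m × Fin m) ℂ g (MvPolynomial.X (a, b))) = 0)
    (htight : ∑ a, p a + ∑ b, q b = e) :
    HasDetRepr (linSubst (Fin m × Fin m) ℂ u
      (MvPolynomial.weightedHomogeneousComponent w e (linSubst (Fin m × Fin m) ℂ g (detPoly (Fin m) ℂ)))) m := by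
  set L : Matrix (Fin m) (Fin m) (MvPolynomial (Fin m × Fin m) ℂ) :=
    (linSubst (Fin m × Fin m) ℂ g).toRingHom.mapMatrix (Matrix.mvPolynomialX (Fin m) (Fin m) ℂ) with hL
  have hLab : ∀ a b, L a b = linSubst (Fin m × Fin m) ℂ g (MvPolynomial.X (a, b)) := fun a b => by
    simp only [hL, RingHom.mapMatrix_apply, Matrix.map_apply, Matrix.mvPolynomialX_apply]; rfl
  have hdet : linSubst (Fin m × Fin m) ℂ g (detPoly (Fin m) ℂ) = L.det := by
    rw [hL, detPoly, ← RingHom.map_det]; rfl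
  have hlin : ∀ a b, (L a b).IsHomogeneous 1 := fun a b => by
    rw [hLab]; exact linSubst_isHomogeneous g (MvPolynomial.isHomogeneous_X ℂ (a, b))
  have hfeasL : ∀ a b j, p a + q b < j → MvPolynomial.weightedHomogeneousComponent w j (L a b) = 0 :=
    fun a b j hj => by rw [hLab]; exact hfeas a b j hj
  have hframe := stub_deborderFrame (Fin m × Fin m) (Fin m) L hlin w e p q hfeasL htight.ge
  rw [htight, Nat.sub_self] at hframe
  -- order `0`: the coefficient of `ε^0` of `det (Σ_{i ≤ 0} ε^i B'_i)` is `det B'_0`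
  have hB0 : (Matrix.det (Matrix.of fun a b => ∑ i ∈ Finset.range (0 + 1), Polynomial.monomial i
      (if i ≤ p a + q b then MvPolynomial.weightedHomogeneousComponent w (p a + q b - i) (L a b) else 0))).coeff 0 =
      (Matrix.of fun a b => MvPolynomial.weightedHomogeneousComponent w (p a + q b) (L a b)).det := by
    have hM : (Matrix.of fun a b => ∑ i ∈ Finset.range (0 + 1), Polynomial.monomial i
        (if i ≤ p a + q b then MvPolynomial.weightedHomogeneousComponent w (p a + q b - i) (L a b) else 0)) =
        (Polynomial.C : MvPolynomial (Fin m × Fin m) ℂ →+* _).mapMatrix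
          (Matrix.of fun a b => MvPolynomial.weightedHomogeneousComponent w (p a + q b) (L a b)) := by
      ext a b
      simp [Polynomial.monomial_zero_left]
    rw [hM, ← RingHom.map_det, Polynomial.coeff_C_zero]
  rw [hB0] at hframe
  rw [hdet, hframe]
  refine hasDetRepr_linSubst u ⟨Matrix.of fun a b => MvPolynomial.weightedHomogeneousComponent w (p a + q b) (L a b),
    fun a b => ?_, rfl⟩
  exact (isHomogeneous_weightedHomogeneousComponent (hlin a b) w _).totalDegree_le

/-- Hence a TIGHT toric representation of the padded permanent at size `m` gives `dc(per_n) ≤ m` (`stub_unpad`): such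
representations cannot undercut the determinantal complexity of the permanent, whatever the weights. [folklore] -/
theorem hasDetRepr_of_tight_potentials {n m : ℕ} [NeZero m] (hnm : n ≤ m)
    (u g : Matrix (Fin m × Fin m) (Fin m × Fin m) ℂ) (w : Fin m × Fin m → ℕ) (e : ℕ) (p q : Fin m → ℕ)
    (hfeas : ∀ a b j, p a + q b < j →
      MvPolynomial.weightedHomogeneousComponent w j (linSubst (Fin m × Fin m) ℂ g (MvPolynomial.X (a, b))) = 0)
    (htight : ∑ a, p a + ∑ b, q b = e)
    (hpp : paddedPerPoly ℂ n m = linSubst (Fin m × Fin m) ℂ u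
      (MvPolynomial.weightedHomogeneousComponent w e (linSubst (Fin m × Fin m) ℂ g (detPoly (Fin m) ℂ)))) :
    HasDetRepr (perPoly (Fin n) ℂ) m :=
  stub_unpad n m hnm m (hpp ▸ hasDetRepr_slice_of_tight_potentials u g w e p q hfeas htight)

/-- **`PotentialGapQP ⇒ ToricDeborderQP`** (registered stub `toricDeborderQP_of_potentialGapQP` of crux stmt-5778, line
`toric-face-debordering`, reshape 4b): the composite of `orderBoundQP_of_potentialGapQP` and
`toricDeborderQP_of_orderBoundQP`.  A quasi-polynomial Murota gap for extremal toric representations of padded permanents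
would therefore close the line's open stub. [folklore] -/
theorem toricDeborderQP_of_potentialGapQP :
    (∃ c₁ : ℕ, ∀ (n m : ℕ) [NeZero m], 3 ≤ n → n ≤ m → (∃ (u g : Matrix.GeneralLinearGroup (Fin m × Fin m) ℂ) (w : Fin m × Fin m → ℕ) (e : ℕ), (∀ d ∈ (linSubst (Fin m × Fin m) ℂ (g : Matrix (Fin m × Fin m) (Fin m × Fin m) ℂ) (detPoly (Fin m) ℂ)).support, Finsupp.weight w d ≤ e) ∧ paddedPerPoly ℂ n m = linSubst (Fin m × Fin m) ℂ (u : Matrix (Fin m × Fin m) (Fin m × Fin m) ℂ) (MvPolynomial.weightedHomogeneousComponent w e (linSubst (Fin m × Fin m) ℂ (g : Matrix (Fin m × Fin m) (Fin m × Fin m) ℂ) (detPoly (Fin m) ℂ)))) → ∃ (u g : Matrix (Fin m × Fin m) (Fin m × Fin m) ℂ) (w : Fin m × Fin m → ℕ) (e : ℕ) (p q : Fin m → ℕ), (∀ a b j, p a + q b < j → MvPolynomial.weightedHomogeneousComponent w j (linSubst (Fin m × Fin m) ℂ g (MvPolynomial.X (a, b))) = 0) ∧ e ≤ ∑ a, p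 a + ∑ b, q b ∧ ∑ a, p a + ∑ b, q b - e ≤ 2 ^ ((Nat.log 2 m + c₁) ^ c₁) ∧ paddedPerPoly ℂ n m = linSubst (Fin m × Fin m) ℂ u (MvPolynomial.weightedHomogeneousComponent w e (linSubst (Fin m × Fin m) ℂ g (detPoly (Fin m) ℂ)))) → ∃ c₁ : ℕ, ∀ (n m : ℕ) [NeZero m], 3 ≤ n → n ≤ m → (∃ (u g : Matrix.GeneralLinearGroup (Fin m × Fin m) ℂ) (w : Fin m × Fin m → ℕ) (e : ℕ), (∀ d ∈ (linSubst (Fin m × Fin m) ℂ (g : Matrix (Fin m × Fin m) (Fin m × Fin m) ℂ) (detPoly (Fin m) ℂ)).support, Finsupp.weight w d ≤ e) ∧ paddedPerPoly ℂ n m = linSubst (Fin m × Fin m) ℂ (u : Matrix (Fin m × Fin m) (Fin m × Fin m) ℂ) (MvPolynomial.weightedHomogeneousComponent w e (linSubst (Fin m × Fin m) ℂ (g : Matrix (Fin m × Fin m) (Fin m × Fin m) ℂ) (detPoly (Fin m) ℂ)))) → determinantalComplexity (perPoly (Fin n) ℂ) ≤ 2 ^ ((Nat.log 2 m + c₁)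 ^ c₁) :=
  fun hP => toricDeborderQP_of_orderBoundQP (orderBoundQP_of_potentialGapQP hP)

/-- **Crux 4 from a quasi-polynomial Murota gap and eventual affine hardness**:
`PotentialGapQP ∧ (eventual super-qp dc(per_n)) ⟹ ToricWitnessObstructionQP` (stmt-14753), through
`toricWitnessObstructionQP_of_toricDeborderQP` (p88978). [folklore] -/
theorem toricWitnessObstructionQP_of_potentialGapQP
    (hP : ∃ c₁ : ℕ, ∀ (n m : ℕ) [NeZero m], 3 ≤ n → n ≤ m →
    (∃ (u g : Matrix.GeneralLinearGroup (Fin m × Fin m) ℂ) (w : Fin m × Fin m → ℕ) (e : ℕ),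
        (∀ d ∈ (linSubst (Fin m × Fin m) ℂ (g : Matrix (Fin m × Fin m) (Fin m × Fin m) ℂ) (detPoly (Fin m) ℂ)).support,
          Finsupp.weight w d ≤ e) ∧
        paddedPerPoly ℂ n m =
          linSubst (Fin m × Fin m) ℂ (u : Matrix (Fin m × Fin m) (Fin m × Fin m) ℂ)
            (MvPolynomial.weightedHomogeneousComponent w e
              (linSubst (Fin m × Fin m) ℂ (g : Matrix (Fin m × Fin m) (Fin m × Fin m) ℂ) (detPoly (Fin m) ℂ)))) →
      ∃ (u g : Matrix (Fin m × Fin m) (Fin m × Fin m) ℂ) (w : Fin m × Fin m → ℕ) (e : ℕ) (p q : Fin m → ℕ),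
        (∀ a b j, p a + q b < j →
          MvPolynomial.weightedHomogeneousComponent w j (linSubst (Fin m × Fin m) ℂ g (MvPolynomial.X (a, b))) = 0) ∧
        e ≤ ∑ a, p a + ∑ b, q b ∧
        ∑ a, p a + ∑ b, q b - e ≤ 2 ^ ((Nat.log 2 m + c₁) ^ c₁) ∧
        paddedPerPoly ℂ n m = linSubst (Fin m × Fin m) ℂ u
          (MvPolynomial.weightedHomogeneousComponent w e (linSubst (Fin m × Fin m) ℂ g (detPoly (Fin m) ℂ))))
    (hdc : ∀ c : ℕ, ∃ n₀ : ℕ, ∀ n ≥ n₀,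
    2 ^ ((Nat.log 2 n + c) ^ c) < determinantalComplexity (perPoly (Fin n) ℂ)) :
    Summit.ValiantsHypothesis.ValiantsHypothesis.Theses.BorderApolarity.ToricWitnessObstructionQP :=
  toricWitnessObstructionQP_of_toricDeborderQP (toricDeborderQP_of_potentialGapQP hP) hdc

/-- **Crux 2 from crux 3, a quasi-polynomial Murota gap and eventual affine hardness**:
`ToricFixedPoints ∧ PotentialGapQP ∧ (eventual super-qp dc(per_n)) ⟹ FixedWitnessObstructionQP` (stmt-5778), through
`FixedWitnessObstructionQP_of_toricFixedPoints` (p85323). [folklore] -/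
theorem fixedWitnessObstructionQP_of_potentialGapQP
    (h5779 : Summit.ValiantsHypothesis.ValiantsHypothesis.Theses.BorderApolarity.ToricFixedPoints)
    (hP : ∃ c₁ : ℕ, ∀ (n m : ℕ) [NeZero m], 3 ≤ n → n ≤ m →
    (∃ (u g : Matrix.GeneralLinearGroup (Fin m × Fin m) ℂ) (w : Fin m × Fin m → ℕ) (e : ℕ),
        (∀ d ∈ (linSubst (Fin m × Fin m) ℂ (g : Matrix (Fin m × Fin m) (Fin m × Fin m) ℂ) (detPoly (Fin m) ℂ)).support,
          Finsupp.weight w d ≤ e) ∧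
        paddedPerPoly ℂ n m =
          linSubst (Fin m × Fin m) ℂ (u : Matrix (Fin m × Fin m) (Fin m × Fin m) ℂ)
            (MvPolynomial.weightedHomogeneousComponent w e
              (linSubst (Fin m × Fin m) ℂ (g : Matrix (Fin m × Fin m) (Fin m × Fin m) ℂ) (detPoly (Fin m) ℂ)))) →
      ∃ (u g : Matrix (Fin m × Fin m) (Fin m × Fin m) ℂ) (w : Fin m × Fin m → ℕ) (e : ℕ) (p q : Fin m → ℕ),
        (∀ a b j, p a + q b < j →
          MvPolynomial.weightedHomogeneousComponent w j (linSubst (Fin m × Fin m) ℂ g (MvPolynomial.X (a, b))) = 0) ∧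
        e ≤ ∑ a, p a + ∑ b, q b ∧
        ∑ a, p a + ∑ b, q b - e ≤ 2 ^ ((Nat.log 2 m + c₁) ^ c₁) ∧
        paddedPerPoly ℂ n m = linSubst (Fin m × Fin m) ℂ u
          (MvPolynomial.weightedHomogeneousComponent w e (linSubst (Fin m × Fin m) ℂ g (detPoly (Fin m) ℂ))))
    (hdc : ∀ c : ℕ, ∃ n₀ : ℕ, ∀ n ≥ n₀,
    2 ^ ((Nat.log 2 n + c) ^ c) < determinantalComplexity (perPoly (Fin n) ℂ)) :
    Summit.ValiantsHypothesis.ValiantsHypothesis.Theses.BorderApolarity.FixedWitnessObstructionQP :=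
  FixedWitnessObstructionQP_of_toricFixedPoints h5779 (toricDeborderQP_of_potentialGapQP hP) hdc

end Summit.ValiantsHypothesis.ValiantsHypothesis.Theorems.BorderApolarityFixedWitnessObstructionQP
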